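import Literature.Claims.NS.ZgurovskyKasyanov2012
import Literature.Claims.NS.Chio2026
import HarnessLib

/-!
# Claim skeleton C105 — Hlomuka 2010, «On the existence and uniqueness of the 'weak' solution to the sixth problem of the millennium»

**Cite header.** Joe Hlomuka, *On the existence and uniqueness of the 'weak' solution to the sixth
problem of the millennium*, Far East J. Appl. Math. **40** (2010) no. 2, 153–163 (Pushpa; «Published
Online: May 4, 2010»; Zbl 1426.35178; no DOI), bib key `Hlomuka2010`; text of record = the publisher
PDF (11 pp.; `p.` = PRINTED page = PDF page + 152; `(n)` = the paper's display numbers), materialised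
with page renders in `run/shared/lean/pub/ns-claims/sources/Hlomuka2010/` (LOCATORS by ns-claims-lit-1).
JOURNAL CLAIM under adjudication (D-0090 NS-claims sweep, cell `ns-claims`, row C105, QUICK grain,
RULINGS v1.29x (2)) — this file TYPES the claimed statement and the text's own numbered propositions as
`Prop`s and asserts none of them; the only theorems are compositions by pure logic and one algebraic
unfolding of equation (22). Nothing here is a theorem about Navier–Stokes.
[cite: Hlomuka2010, abstract p.153; Main Theorem 8.2 p.161; Remarks 8.3 p.161–162]

**Setting (§1–§3, p.154–155).** «Ω : an open bounded domain in R³» with «smooth boundary ∂Ω»;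
`ρ, μ` positive constants; problem (1) p.154: «we seek v(·,t); p(x) ∈ L²((0,T), H²(Ω)) such that
(a) ρ∂ₜv + ρ[(v·∇)v] − μΔv + ∇p = f, x ∈ Ω, t ∈ (0,T), f ∈ L²(Ω); (b) γ₀v(y,t) = 0, y ∈ ∂Ω (a no-slip
condition); (c) v(x,0) = v⁰(x); (d) ∇·v = 0», `T < ∞`; `Y := L²([0,T), H²(Ω))` (p.154);
«Θ := {v(x,t) ∈ Y : γ₀v(y,t) = 0, y ∈ ∂Ω; v(x,0) = v⁰(x); ∇·v(x,t) = 0}» (p.155); from p.158 on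
«we take f ≡ 0» («according to Option A in [2]»; [2] = the CMI problem description).
RENDERING (QUICK grain, the cell's standard one — cf. `Chebiam2025`, `Chio2026`): fields are functions
`ℝ → ℝ³ → ℝ³` jointly `C^∞` on the closed slab `[0,T] × ℝ³` (so that every rendered member of `Θ` is a
bona fide element of `Y`; values outside `Ω` are never constrained except on `∂Ω`), «γ₀v = 0» = `v(t,·) = 0`
on `frontier Ω`, `∇·v = 0` and `v(·,0) = v⁰` pointwise on `Ω`; (1)(a)–(d) with `f ≡ 0` rendered
classically by the tree's `Chio2026.IsStrongSolutionOn Ω (Icc 0 T) (μ/ρ) v⁰ v q` (divide (1)(a) by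
`ρ`; `q = p/ρ`). TODO(general form): `v ∈ L²([0,T),H²(Ω))` with distributional (1)(a). The smooth
domain is the tree's `ZgurovskyKasyanov2012.IsSmoothDomain` (bounded, `Ω = {φ < 0}`, `∇φ ≠ 0` on `{φ = 0}`).

**Claimed statement (verbatim).** Abstract p.153: «… we present the analysis of the homogeneous case,
leading to the existence and uniqueness of the solution to Option A in the statement of the problem as
it appears in [2]. … we proceed to confirm the existence and uniqueness of the 'weak' solution to
Option A of the problem»; §7 last paragraph p.160: «we are now ready to set up the problem (Option A in
[2]) in order to deduce the existence and uniqueness of the 'weak' solution to problem (1)»; §8 title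
p.160 «The Existence and Uniqueness for the Solution to the Problem (Option A in [2])»; Remarks 8.3 (c)
p.162: «The fixed-point of (22), which is the solution to Option A … we assert that the fixed-point of
(22) is global on time». Typed as `ClaimedTheorem`: for every smooth bounded `Ω`, `ρ, μ, T > 0` and
admissible datum `v⁰`, problem (1) with `f ≡ 0` has exactly one solution in `Θ` (the rendering above).

**Clay delta (reference `Literature.Claims.NS.ClayVariants`).** Nearest: (A), by the author's own label
«Option A». Δ1 DOMAIN: open BOUNDED `Ω ⊂ ℝ³` with no-slip boundary — neither `ℝ³` (A) nor `𝕋³` (B)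
(«OTHER: no implication to or from (A)–(D) in print», ClayVariants §3 Δ1). Δ4 DATA: `v⁰ ∈ H²(Ω)` with
(7) `½‖v⁰‖²_{H²(Ω)} ≤ C`, zero trace, divergence free — not the class (4) (Remark 8.3 (a) p.162 «in a
way, we can claim that our v⁰(x) satisfies, to a certain extent, condition (4)»). Δ5 SOLUTION NOTION:
an element of `Θ ⊂ L²([0,T),H²(Ω))`; pressure «eliminated» (p.160). Δ6 CONCLUSION: existence and
uniqueness in `Θ`; no smoothness sentence in the text. Δ7: `T < ∞` arbitrary, then «Should we
"stretch" the interval [0,T) to [0,∞) the inequality (23) still holds» (p.162). `clay_of_claimed` is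
NOT provable; the identification with (A) is the abstract's sentence, typed as `ClayBridge`.

**ORDERED STEP INDEX** (dependency order of the printed argument for Main Theorem 8.2 and Remarks 8.3;
ties by print order). Steps 1–4 are the printed SUPPORT CHAIN of Step 5 (Lemma 8.1 ← (8); Prop 7.4 ←
Props 7.2, 7.3; «Then, by the Leray-Schaueder fixed-point Theorem (p. 245 in [8]), the solution to the
equation does exist», p.161 l.11–12); they are typed as the paper states them and are NOT re-derived
here (the Leray–Schauder principle delivers a fixed point of `K = (I − μΔ)⁻¹A`, i.e. of (21), not a
solution of (22) with `α ∈ (0,1)` — recorded, not bridged, TYPING-HYGIENE 8).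
* Step 1 = `Step1_energyDecay8` — §5 (2)–(8) p.156–157 and (13) p.158 (`f ≡ 0`): a solution of (1) in
  `Θ` obeys `‖v(·,t)‖_{L²(Ω)} ≤ ‖v⁰‖_{H²(Ω)}·exp(−μ c_ρ t)` (Poincaré constant (4)). Feeds Lemma 8.1.
* Step 2 = `Step2_Prop72` — Prop 7.2 p.159–160 with (18)/(20): `I − μΔ` is injective on `Θ` with a
  bounded inverse: `(1 − C₁)‖v‖_Y ≤ ‖(I − μΔ)v‖_Y`, «Ker(I − μΔ) = {0}». Feeds Prop 7.4 and (22).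
  (ERRATUM-GRADE, not a Step, not consumed: `Erratum19_laplacianBounded` = p.159 «By (16), μΔ is bounded
  on Θ. Hence, there exists C₁ > 0 such that ‖μΔv‖_Y ≤ C₁‖v‖_Y» / (19).)
* Step 3 = `Step3_Prop73_finiteDim` — Prop 7.3 p.160, the proof's only ground: «Since Ω ⊂ R³
  (according to Option A in [2]), Θ is finite dimensional» (⇒ «I − μΔ is compact on Θ» ⇒ Prop 7.4
  «(I − μΔ)⁻¹A is compact on Θ»; with (16) `A = I − μΔ` the operator of Prop 7.4 is the identity of `Θ`,
  whose compactness is again finite-dimensionality — Riesz's lemma — so Props 7.3/7.4 carry no content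
  beyond this sentence). Typed: `Θ` lies in the span of finitely many fields (equality on `[0,T] × Ω`).
* Step 4 = `Step4_Lemma81` — Lemma 8.1 p.161: «For v ∈ Θ, the solution to v = α(I − μΔ)⁻¹Av; α ∈ (0,1),
  is uniformly bounded» (proof: «By (8) for f ≡ 0»). Feeds Step 5 (a-priori bound).
* Step 5 = `Step5_Thm82_exists` — Main Theorem 8.2, proof l.9–12 p.161: «the solution to the equation
  does exist» (equation (22) `v = α(I − μΔ)⁻¹Av; α ∈ (0,1), for v ∈ Θ`).
* Step 6 = `Step6_Thm82_unique` — Main Theorem 8.2 statement + proof l.13–17 p.161: «has at most one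
  solution» («Since by (16), ‖α(I − μΔ)⁻¹A‖_Y < 1, α ∈ (0,1), uniqueness follows»).
* Step 7 = `Step7_Remark83c_bridge` — Remarks 8.3 (c) p.162 with §7 last paragraph p.160 and the §8
  title: «The fixed-point of (22), which is the solution to Option A» — the identification of the
  solutions of (22) in `Θ` with the ('weak') solutions of (1), `f ≡ 0`.
* Clay link = `ClayBridge` — abstract p.153 («Option A … as it appears in [2]»).
EQUATION (22) AS PRINTED. §6 p.158 DEFINES `A : Θ → Θ` as the Riesz representative of
`Φ(v,w) = (v,w)_Y − μ(Δv,w)_Y` and concludes «I − μΔ = A» (16); §8 (21) «(I − μΔ)v = Av»; hence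
`(I − μΔ)⁻¹Av = (I − μΔ)⁻¹(I − μΔ)v = v` on `Θ` by Prop 7.2, and (22) is the equation `v = αv`,
`α ∈ (0,1)` — the evaluation the author himself uses at p.161 l.−4 («Since by (16), ‖α(I − μΔ)⁻¹A‖_Y < 1»).
`Eq22` types (22) after this substitution (there is no other content of `A` in the text); `eq22_iff_zero`
unfolds it; the un-substituted «cleared» form `(I − μΔ)v = α(I − μΔ)v` is `Eq22L` (equivalent given
Step 2; relation not proved here), and the Leray–Schauder reading `α = 1` (equation (21), satisfied by
every member of `Θ`) is recorded as the charitable variant `Step5R_Thm82_existsK`.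
COMPOSITION: `claim_of_steps : Step5_Thm82_exists → Step6_Thm82_unique → Step7_Remark83c_bridge →
ClaimedTheorem` PROVED (pure logic); `clay_of_bridge : ClayBridge → ClaimedTheorem → clayR3.Regularity`.

WHAT THIS IS NOT: not a claim about NS regularity or blow-up; not a claim about any author beyond the
typed locator.
-/

open Set MeasureTheory Literature.Analysis.FluidPDE Literature.Claims.NS.ClayVariants
open scoped ContDiff Laplacian InnerProductSpace

namespace Literature.Claims.NS.Hlomuka2010

open Literature.Claims.NS.ZgurovskyKasyanov2012 (IsSmoothDomain)

noncomputable section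

/-! ## Vocabulary (definitions with bodies; nothing asserted) -/

/-- Physical space `ℝ³` («Ω : an open bounded domain in R³», p.154). [cite: Hlomuka2010, §1 p.154] -/
abbrev E3 : Type := EuclideanSpace ℝ (Fin 3)

/-- The coordinate vector `e_i` (p.154 «x = (x₁, x₂, x₃)»). [folklore] -/
def e (i : Fin 3) : E3 := EuclideanSpace.single i (1 : ℝ)

/-- `‖w‖²_{L²(Ω)} = ∫_Ω |w(x)|² dx` — the spatial norm the text writes `‖·‖_Y` / `‖·‖_{L²(Ω)}` at a
fixed time ((3)–(4) p.156, (13) p.158, (23) p.162). Bochner integral; finite for the smooth fields on a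
bounded `Ω` used below. [cite: Hlomuka2010, (4) p.156; (13) p.158] -/
def l2NormSq (Ω : Set E3) (w : E3 → E3) : ℝ :=
  ∫ x in Ω, ‖w x‖ ^ 2

/-- The `H²(Ω)` density of Remarks 8.3 (a) p.162, «‖v⁰‖_{H²(Ω)} = (Σ_{0≤|α|≤2} |∂^{|α|}v⁰/∂x_{α₀}∂x_{α₁}∂x_{α₂}|²)^{1/2}»,
rendered with coordinate partials `∂ᵢ = D·(eᵢ)`, `∂ᵢ∂ⱼ = D²·(eᵢ,eⱼ)`; mixed partials are summed over
ORDERED pairs, so this density is ≥ the printed one (every inequality below with it on the larger side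
is implied by the printed inequality). [cite: Hlomuka2010, Remarks 8.3 (a) p.162; (7) p.156] -/
def h2Density (w : E3 → E3) (x : E3) : ℝ :=
  ‖w x‖ ^ 2 + ∑ i : Fin 3, ‖fderiv ℝ w x (e i)‖ ^ 2 +
    ∑ i : Fin 3, ∑ j : Fin 3, ‖iteratedFDeriv ℝ 2 w x ![e i, e j]‖ ^ 2

/-- `‖w‖²_{H²(Ω)}` (Remarks 8.3 (a) p.162; (7) p.156 «½‖v⁰(x)‖²_{H²(Ω)} ≤ C»). [cite: Hlomuka2010, (7) p.156; p.162] -/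
def h2NormSq (Ω : Set E3) (w : E3 → E3) : ℝ :=
  ∫ x in Ω, h2Density w x

/-- The operator `I − μΔ` of (14)–(16) p.158 and §7–§8, acting on a spatial slice:
`((I − μΔ)w)(x) = w(x) − μ·Δw(x)` (Mathlib's pointwise Laplacian). [cite: Hlomuka2010, (16) p.158; (21) p.160] -/
def opL (μ : ℝ) (w : E3 → E3) (x : E3) : E3 :=
  w x - μ • (Δ w) x

/-- ADMISSIBLE DATUM `v⁰` (p.154 (1)(c), p.155 definition of `Θ`, (7) p.156): rendered as a `C^∞` field on
`ℝ³` (for `v⁰ ∈ H²(Ω)`), divergence free in `Ω` and vanishing on `∂Ω` (the compatibility the definition of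
`Θ` imposes at `t = 0`); (7) `½‖v⁰‖²_{H²(Ω)} ≤ C` is automatic for such a field on a bounded `Ω` and is
not a constraint. [cite: Hlomuka2010, (1)(c) p.154; Θ p.155; (7) p.156] -/
structure IsDatum (Ω : Set E3) (v₀ : E3 → E3) : Prop where
  /-- `v⁰ ∈ H²(Ω)`, rendered smooth -/
  smooth : ContDiff ℝ ∞ v₀
  /-- `∇·v⁰ = 0` in `Ω` -/
  divFree : ∀ x ∈ Ω, VectorCalculus.divergence v₀ x = 0
  /-- `γ₀v⁰ = 0` on `∂Ω` -/
  noSlip : ∀ x ∈ frontier Ω, v₀ x = 0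

/-- MEMBERSHIP IN `Θ` (p.155): «Θ := {v(x,t) ∈ Y : γ₀v(y,t) = 0, y ∈ ∂Ω; v(x,0) = v⁰(x); ∇·v(x,t) = 0}»,
`Y = L²([0,T),H²(Ω))` (p.154), in the smooth rendering of the module docstring: `v` jointly `C^∞` on
`[0,T] × ℝ³` (⇒ `v ∈ Y`), `v(t,·) = 0` on `∂Ω`, `v(0,·) = v⁰` and `∇·v(t,·) = 0` on `Ω`, for `t ∈ [0,T]`.
[cite: Hlomuka2010, Θ p.155; Y p.154] -/
structure InTheta (Ω : Set E3) (T : ℝ) (v₀ : E3 → E3) (v : ℝ → E3 → E3) : Prop where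
  /-- `v ∈ Y`, rendered: jointly smooth on the closed slab -/
  smooth : IsSmoothSpaceTimeOn (Icc 0 T) v
  /-- «γ₀v(y,t) = 0, y ∈ ∂Ω» -/
  noSlip : ∀ t ∈ Icc 0 T, ∀ x ∈ frontier Ω, v t x = 0
  /-- «v(x,0) = v⁰(x)» on `Ω` -/
  initial : ∀ x ∈ Ω, v 0 x = v₀ x
  /-- «∇·v(x,t) = 0» on `Ω` -/
  divFree : ∀ t ∈ Icc 0 T, ∀ x ∈ Ω, VectorCalculus.divergence (v t) x = 0

/-- `v` SOLVES PROBLEM (1) WITH `f ≡ 0` and pressure `p = ρ q` on `[0,T] × Ω` (p.154 (1)(a)–(d); p.158 «we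
take f ≡ 0»): (1)(a) divided by `ρ` is `∂ₜv + (v·∇)v = −∇q + (μ/ρ)Δv`, rendered classically by the tree's
`Chio2026.IsStrongSolutionOn` (smooth slices, momentum and `∇·v = 0` pointwise in `Ω`, no-slip on `∂Ω`,
datum `v⁰`). [cite: Hlomuka2010, (1) p.154; p.158] -/
def SolvesNS (Ω : Set E3) (T ρ μ : ℝ) (v₀ : E3 → E3) (v : ℝ → E3 → E3) (q : ℝ → E3 → ℝ) : Prop :=
  Chio2026.IsStrongSolutionOn Ω (Icc 0 T) (μ / ρ) v₀ v q

/-- EQUATION (22) p.161, «v = α(I − μΔ)⁻¹Av; α ∈ (0,1), for v ∈ Θ», AS PRINTED once the text's own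
identities are substituted: `A` is DEFINED by (15)–(16) p.158 with «I − μΔ = A» (16), (21) p.160 reads
«(I − μΔ)v = Av», and `(I − μΔ)⁻¹` is the inverse of Prop 7.2, so `(I − μΔ)⁻¹Av = v` and (22) is
`v = αv` on `[0,T] × Ω` (the author's evaluation «by (16), ‖α(I − μΔ)⁻¹A‖_Y < 1», p.161 l.−4).
See `eq22_iff_zero`, and `Eq22L` for the cleared form. [cite: Hlomuka2010, (22) p.161; (21) p.160; (16) p.158] -/
def Eq22 (Ω : Set E3) (T α : ℝ) (v : ℝ → E3 → E3) : Prop :=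
  ∀ t ∈ Icc 0 T, ∀ x ∈ Ω, v t x = α • v t x

/-- The CLEARED form of (22): apply `I − μΔ` to both sides and use (21) «(I − μΔ)v = Av»:
`(I − μΔ)v = α(I − μΔ)v` on `[0,T] × Ω`. Equivalent to `Eq22` given Prop 7.2 (`Step2_Prop72`:
«Ker(I − μΔ) = {0}», p.160) — the equivalence is not proved in this file. Referee's variant.
[cite: Hlomuka2010, (21)–(22) p.160–161] -/
def Eq22L (Ω : Set E3) (T μ α : ℝ) (v : ℝ → E3 → E3) : Prop :=
  ∀ t ∈ Icc 0 T, ∀ x ∈ Ω, opL μ (v t) x = α • opL μ (v t) x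

/-- Pure algebra: for `α ≠ 1`, equation (22) as printed — «v = α(I − μΔ)⁻¹Av; α ∈ (0,1)» with (16)/(21)
substituted — says `v ≡ 0` on `[0,T] × Ω`. [cite: Hlomuka2010, (22) p.161; (16) p.158] -/
theorem eq22_iff_zero {Ω : Set E3} {T α : ℝ} (hα : α ≠ 1) {v : ℝ → E3 → E3} :
    Eq22 Ω T α v ↔ ∀ t ∈ Icc 0 T, ∀ x ∈ Ω, v t x = 0 := by
  refine ⟨fun h t ht x hx => ?_, fun h t ht x hx => by simp [h t ht x hx]⟩
  have h1 : (1 - α) • v t x = 0 := by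
    rw [sub_smul, one_smul, sub_eq_zero]
    exact h t ht x hx
  rcases smul_eq_zero.mp h1 with h2 | h2
  · exact absurd (sub_eq_zero.mp h2).symm hα
  · exact h2

/-! ## The claimed statement -/

/-- **The claimed theorem** (abstract p.153; §7 last paragraph p.160; §8 p.160–161; Remarks 8.3 (c)
p.162), in the author's setting: for every open bounded `Ω ⊂ ℝ³` with smooth boundary, all constants
`ρ, μ > 0`, every `T > 0` and every admissible datum `v⁰`, problem (1) with `f ≡ 0` has a solution in
`Θ`, and any two solutions in `Θ` coincide on `[0,T] × Ω` («the existence and uniqueness of the 'weak'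
solution to problem (1)» = «the solution to Option A»). [cite: Hlomuka2010, abstract p.153; §8 p.160–162] -/
def ClaimedTheorem : Prop :=
  ∀ Ω : Set E3, IsSmoothDomain Ω → Ω.Nonempty → ∀ ρ μ T : ℝ, 0 < ρ → 0 < μ → 0 < T →
    ∀ v₀ : E3 → E3, IsDatum Ω v₀ →
      ∃ v : ℝ → E3 → E3, InTheta Ω T v₀ v ∧ (∃ q : ℝ → E3 → ℝ, SolvesNS Ω T ρ μ v₀ v q) ∧
        ∀ w : ℝ → E3 → E3, InTheta Ω T v₀ w → (∃ q : ℝ → E3 → ℝ, SolvesNS Ω T ρ μ v₀ w q) →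
          ∀ t ∈ Icc 0 T, ∀ x ∈ Ω, w t x = v t x

/-- **Clay link — abstract p.153** «the existence and uniqueness of the solution to Option A in the
statement of the problem as it appears in [2]» ([2] = the CMI text): the identification of the claimed
theorem with Clay (A) = `ClayVariants.clayR3.Regularity`. Axes on which `RegularityAt.mono` cannot be
invoked (the statement is not of schema shape): Δ1 DOMAIN (bounded `Ω`, no-slip), Δ4 DATA, Δ5 SOLUTION
NOTION, Δ6 CONCLUSION (module docstring). A «wrong problem» verdict cites this decl.
[cite: Hlomuka2010, abstract p.153; Remarks 8.3 p.162] -/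
def ClayBridge : Prop := ClaimedTheorem → clayR3.Regularity

/-! ## The steps (none asserted) -/

/-- **Step 1 — the energy decay (8) p.157 / (13) p.158 with `f ≡ 0`** (derived p.156 by «tak[ing] the
scalar product of 1(a) with v ∈ Θ», (3) `E′(t) + μ‖∇v(t)‖²_{L²(Ω)} = ∫fv`, the Poincaré inequality (4)
`‖∇v(t)‖² ≥ c_ρ‖v(t)‖²` «since Ω is bounded», (5)–(6)): there is `c_ρ > 0` (depending on `Ω`, `ρ`, `μ`)
such that every solution of (1), `f ≡ 0`, lying in `Θ` satisfies
`‖v(·,t)‖_{L²(Ω)} ≤ ‖v⁰‖_{H²(Ω)}·exp(−μ c_ρ t)` for `t ∈ [0,T]` (the form used in Lemma 8.1 p.161 and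
(23) p.162). [cite: Hlomuka2010, (3)–(8) p.156–157; (13) p.158; (23) p.162] -/
def Step1_energyDecay8 : Prop :=
  ∀ Ω : Set E3, IsSmoothDomain Ω → Ω.Nonempty → ∀ ρ μ : ℝ, 0 < ρ → 0 < μ →
    ∃ c : ℝ, 0 < c ∧ ∀ T : ℝ, 0 < T → ∀ v₀ : E3 → E3, IsDatum Ω v₀ →
      ∀ (v : ℝ → E3 → E3) (q : ℝ → E3 → ℝ), InTheta Ω T v₀ v → SolvesNS Ω T ρ μ v₀ v q →
        ∀ t ∈ Icc 0 T,
          Real.sqrt (l2NormSq Ω (v t)) ≤ Real.sqrt (h2NormSq Ω v₀) * Real.exp (-(μ * c * t))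

/-- **Step 2 — Proposition 7.2 p.159–160**: «The operator I − μΔ is invertible and (I − μΔ)⁻¹ is a
bounded linear operator on Θ», through (18)/(20) «(1 − C₁)‖v‖_Y ≤ ‖(I − μΔ)v‖_Y» («provided
1 − C₁ > 0») and «Ker(I − μΔ) = {0}». Typed at the grain of (18): a lower bound
`c‖v(·,t)‖_{L²(Ω)} ≤ ‖(I − μΔ)v(·,t)‖_{L²(Ω)}`, one `c > 0` for all members of `Θ` and all `t`.
[cite: Hlomuka2010, Prop 7.2 (18)–(20) p.159–160] -/
def Step2_Prop72 : Prop :=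
  ∀ Ω : Set E3, IsSmoothDomain Ω → Ω.Nonempty → ∀ μ T : ℝ, 0 < μ → 0 < T →
    ∀ v₀ : E3 → E3, IsDatum Ω v₀ →
      ∃ c : ℝ, 0 < c ∧ ∀ v : ℝ → E3 → E3, InTheta Ω T v₀ v → ∀ t ∈ Icc 0 T,
        c * Real.sqrt (l2NormSq Ω (v t)) ≤ Real.sqrt (l2NormSq Ω (opL μ (v t)))

/-- **ERRATUM-GRADE (not a Step; consumed by nothing)** — p.159, proof of Prop 7.2: «By (16), μΔ is
bounded on Θ. Hence, there exists C₁ > 0 such that ‖μΔv‖_Y ≤ C₁‖v‖_Y» and (19)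
«‖(I − μΔ)v‖_Y ≤ C₁′‖v‖_Y»: the Laplacian is asserted bounded in the `L²(Ω)` norm on `Θ`. Recorded so
that a refuter may file the erratum; the conclusion of Prop 7.2 (Step 2) does not need it.
[cite: Hlomuka2010, p.159; (19) p.159] -/
def Erratum19_laplacianBounded : Prop :=
  ∀ Ω : Set E3, IsSmoothDomain Ω → Ω.Nonempty → ∀ μ T : ℝ, 0 < μ → 0 < T →
    ∀ v₀ : E3 → E3, IsDatum Ω v₀ →
      ∃ C : ℝ, ∀ v : ℝ → E3 → E3, InTheta Ω T v₀ v → ∀ t ∈ Icc 0 T,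
        Real.sqrt (l2NormSq Ω (fun x => μ • (Δ (v t)) x)) ≤ C * Real.sqrt (l2NormSq Ω (v t))

/-- **Step 3 — Proposition 7.3 p.160, first sentence of the proof: «Since Ω ⊂ R³ (according to Option A
in [2]), Θ is finite dimensional»** (whence «By Theorems 8.1-4(a) and 8.1-4(b) in [6], I − μΔ is compact
on Θ. By (16) … A is also compact on Θ» and Prop 7.4 «(I − μΔ)⁻¹A is compact on Θ» — with (16) that
operator is the identity of `Θ`, so both compactness statements are this sentence again). Typed: for
every `Ω`, `T`, `v⁰`, the set `Θ` lies in the span of finitely many fields `b₁,…,bₙ`, equality in `Y`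
meaning equality on `[0,T] × Ω`. [cite: Hlomuka2010, Prop 7.3 p.160; Prop 7.4 p.160] -/
def Step3_Prop73_finiteDim : Prop :=
  ∀ Ω : Set E3, IsSmoothDomain Ω → Ω.Nonempty → ∀ T : ℝ, 0 < T → ∀ v₀ : E3 → E3, IsDatum Ω v₀ →
    ∃ (n : ℕ) (b : Fin n → ℝ → E3 → E3), ∀ v : ℝ → E3 → E3, InTheta Ω T v₀ v →
      ∃ c : Fin n → ℝ, ∀ t ∈ Icc 0 T, ∀ x ∈ Ω, v t x = ∑ i, c i • b i t x

/-- **Step 4 — Lemma 8.1 p.161**: «For v ∈ Θ, the solution to v = α(I − μΔ)⁻¹Av; α ∈ (0,1), is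
uniformly bounded» (proof: «By (8) for f ≡ 0 … ‖v(x,t)‖_Y ≤ ‖v⁰(x)‖_{H²(Ω)} exp(−μc_ρt) ≤ C exp(−μc_ρt)
< C»). Typed: one bound `C` for the `L²(Ω)` norms of all solutions of (22) in `Θ` at all times.
[cite: Hlomuka2010, Lemma 8.1 p.161] -/
def Step4_Lemma81 : Prop :=
  ∀ Ω : Set E3, IsSmoothDomain Ω → Ω.Nonempty → ∀ ρ μ T : ℝ, 0 < ρ → 0 < μ → 0 < T →
    ∀ v₀ : E3 → E3, IsDatum Ω v₀ → ∀ α : ℝ, 0 < α → α < 1 →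
      ∃ C : ℝ, ∀ v : ℝ → E3 → E3, InTheta Ω T v₀ v → Eq22 Ω T α v →
        ∀ t ∈ Icc 0 T, Real.sqrt (l2NormSq Ω (v t)) ≤ C

/-- **Step 5 — Main Theorem 8.2, existence sentence, p.161 l.9–12**: «By Lemma 8.1 the solution to the
equation, v = α(I − μΔ)⁻¹Av; α ∈ (0,1), for v ∈ Θ, is uniformly bounded. By Proposition 7.4, the operator
(I − μΔ)⁻¹A is compact. Then, by the Leray-Schaueder fixed-point Theorem (p. 245 in [8]), the solution to
the equation does exist.» Typed as the STATEMENT delivered: for every `α ∈ (0,1)`, equation (22) has a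
solution in `Θ`. [cite: Hlomuka2010, Main Theorem 8.2 p.161] -/
def Step5_Thm82_exists : Prop :=
  ∀ Ω : Set E3, IsSmoothDomain Ω → Ω.Nonempty → ∀ ρ μ T : ℝ, 0 < ρ → 0 < μ → 0 < T →
    ∀ v₀ : E3 → E3, IsDatum Ω v₀ → ∀ α : ℝ, 0 < α → α < 1 →
      ∃ v : ℝ → E3 → E3, InTheta Ω T v₀ v ∧ Eq22 Ω T α v

/-- **Step 5, charitable variant R (referee's; NOT consumed)** — what the Leray–Schauder principle [8,
p.245] concludes from an a-priori bound for `v = αKv`, `α ∈ (0,1)`: a fixed point of `K = (I − μΔ)⁻¹A`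
itself, i.e. a solution in `Θ` of (21) «(I − μΔ)v = Av» — which, `A` being `I − μΔ` by (16), every
member of `Θ` satisfies; so under this reading the sentence asserts only `Θ ≠ ∅` and the whole weight of
the claim moves to Step 7. [cite: Hlomuka2010, (21) p.160; Main Theorem 8.2 p.161] -/
def Step5R_Thm82_existsK : Prop :=
  ∀ Ω : Set E3, IsSmoothDomain Ω → Ω.Nonempty → ∀ μ T : ℝ, 0 < μ → 0 < T →
    ∀ v₀ : E3 → E3, IsDatum Ω v₀ →
      ∃ v : ℝ → E3 → E3, InTheta Ω T v₀ v ∧ ∀ t ∈ Icc 0 T, ∀ x ∈ Ω, opL μ (v t) x = opL μ (v t) x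

/-- **Step 6 — Main Theorem 8.2, statement and uniqueness, p.161**: «For v ∈ Θ, the equation
v = α(I − μΔ)⁻¹Av; α ∈ (0,1) has at most one solution» («‖v − w‖_Y ≤ ‖α(I − μΔ)⁻¹A‖_Y‖v − w‖_Y.
Since by (16), ‖α(I − μΔ)⁻¹A‖_Y < 1, α ∈ (0,1), uniqueness follows»): two solutions of (22) in `Θ`
coincide on `[0,T] × Ω`. [cite: Hlomuka2010, Main Theorem 8.2 p.161] -/
def Step6_Thm82_unique : Prop :=
  ∀ Ω : Set E3, IsSmoothDomain Ω → Ω.Nonempty → ∀ ρ μ T : ℝ, 0 < ρ → 0 < μ → 0 < T →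
    ∀ v₀ : E3 → E3, IsDatum Ω v₀ → ∀ α : ℝ, 0 < α → α < 1 →
      ∀ v w : ℝ → E3 → E3, InTheta Ω T v₀ v → Eq22 Ω T α v → InTheta Ω T v₀ w → Eq22 Ω T α w →
        ∀ t ∈ Icc 0 T, ∀ x ∈ Ω, w t x = v t x

/-- **Step 7 — Remarks 8.3 (c) p.162: «The fixed-point of (22), which is the solution to Option A»**, with
§7's closing paragraph p.160 («to deduce the existence and uniqueness of the 'weak' solution to problem
(1), noting that pressure was eliminated … if the velocity solution existed and is unique, the same would
apply to the pressure») and the §8 title: the solutions of (22) in `Θ` ARE the solutions of problem (1),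
`f ≡ 0`, in `Θ` (for some pressure). Both directions are consumed (existence uses →, uniqueness ←); no
argument is printed for either. [cite: Hlomuka2010, Remarks 8.3 (c) p.162; §7 p.160; §8 title p.160] -/
def Step7_Remark83c_bridge : Prop :=
  ∀ Ω : Set E3, IsSmoothDomain Ω → Ω.Nonempty → ∀ ρ μ T : ℝ, 0 < ρ → 0 < μ → 0 < T →
    ∀ v₀ : E3 → E3, IsDatum Ω v₀ → ∀ α : ℝ, 0 < α → α < 1 →
      ∀ v : ℝ → E3 → E3, InTheta Ω T v₀ v →
        (Eq22 Ω T α v ↔ ∃ q : ℝ → E3 → ℝ, SolvesNS Ω T ρ μ v₀ v q)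

/-! ## Compositions (pure logic) -/

/-- **COMPOSITION** — the printed route to the headline: existence of a solution of (22) in `Θ` (Main
Theorem 8.2, Step 5), its uniqueness (Step 6) and the identification of Remarks 8.3 (c) (Step 7) give the
existence and uniqueness of the solution of (1) in `Θ`, at `α = ½`. [cite: Hlomuka2010, §8 p.160–162] -/
theorem claim_of_steps (h5 : Step5_Thm82_exists) (h6 : Step6_Thm82_unique)
    (h7 : Step7_Remark83c_bridge) : ClaimedTheorem := by
  intro Ω hΩ hne ρ μ T hρ hμ hT v₀ hv₀
  have hα : (0 : ℝ) < 1 / 2 := by norm_num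
  have hα' : (1 / 2 : ℝ) < 1 := by norm_num
  obtain ⟨v, hv, h22⟩ := h5 Ω hΩ hne ρ μ T hρ hμ hT v₀ hv₀ (1 / 2) hα hα'
  refine ⟨v, hv, (h7 Ω hΩ hne ρ μ T hρ hμ hT v₀ hv₀ (1 / 2) hα hα' v hv).mp h22, ?_⟩
  intro w hw hwsol
  have hw22 : Eq22 Ω T (1 / 2) w :=
    (h7 Ω hΩ hne ρ μ T hρ hμ hT v₀ hv₀ (1 / 2) hα hα' w hw).mpr hwsol
  exact h6 Ω hΩ hne ρ μ T hρ hμ hT v₀ hv₀ (1 / 2) hα hα' v w hv h22 hw hw22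

/-- With the abstract's identification, the claim would give Clay (A). [cite: Hlomuka2010, abstract p.153] -/
theorem clay_of_bridge (hb : ClayBridge) (hc : ClaimedTheorem) : clayR3.Regularity := hb hc

/-! ## TRUE column (D-0026 debt, append-only; ns-claims-typist-6 g7): Lemma 8.1, the uniqueness sentence
of Main Theorem 8.2 and the referee's variant R HOLD in the kernel — every solution of (22) with `α < 1`
vanishes on `[0,T] × Ω` (`eq22_iff_zero`), and `Θ ∋` the stationary extension of the datum. -/

/-- `Θ ≠ ∅`: the stationary extension `v(t,x) := v⁰(x)` of an admissible datum lies in `Θ` (jointly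
smooth, no-slip, initial value, divergence free — all inherited from `IsDatum`; the membership
conditions are those of `Θ` p.155). [cite: Hlomuka2010, Θ p.155; (1)(c) p.154] -/
private theorem inTheta_stationary {Ω : Set E3} {T : ℝ} {v₀ : E3 → E3} (hv : IsDatum Ω v₀) :
    InTheta Ω T v₀ (fun _ => v₀) := by
  refine ⟨?_, fun _ _ x hx => hv.noSlip x hx, fun _ _ => rfl, fun _ _ x hx => hv.divFree x hx⟩
  have h : ContDiff ℝ ∞ (Function.uncurry fun (_ : ℝ) => v₀) := hv.smooth.comp contDiff_snd
  exact h.contDiffOn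

/-- **`Step5R_Thm82_existsK` HOLDS (PROVED)**: under the referee's reading (equation (21), satisfied by
every member of `Θ`) the existence sentence of Main Theorem 8.2 asserts only `Θ ≠ ∅`, witnessed by the
stationary extension of the datum. [cite: Hlomuka2010, (21) p.160; Main Theorem 8.2 p.161] -/
theorem step5R_Thm82_existsK_holds : Step5R_Thm82_existsK :=
  fun _ _ _ _ _ _ _ v₀ hv => ⟨fun _ => v₀, inTheta_stationary hv, fun _ _ _ _ => rfl⟩

/-- **`Step6_Thm82_unique` HOLDS (PROVED)**: by `eq22_iff_zero` every solution of (22) with `α ∈ (0,1)`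
vanishes on `[0,T] × Ω`, so any two solutions in `Θ` coincide there — the printed uniqueness sentence of
Main Theorem 8.2, for the reason (16) gives. [cite: Hlomuka2010, Main Theorem 8.2 p.161; (22) p.161; (16) p.158] -/
theorem step6_Thm82_unique_holds : Step6_Thm82_unique := by
  intro _ _ _ _ _ _ _ _ _ _ _ α _ hα1 v w _ hv _ hw t ht x hx
  rw [(eq22_iff_zero hα1.ne).1 hv t ht x hx, (eq22_iff_zero hα1.ne).1 hw t ht x hx]

/-- **`Step4_Lemma81` HOLDS (PROVED)**: every solution of (22) in `Θ` with `α ∈ (0,1)` vanishes on `Ω`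
at each `t ∈ [0,T]` (`eq22_iff_zero`), so its `L²(Ω)` norm is `0 ≤ C := 0` — the uniform bound of
Lemma 8.1, for the reason (16) gives rather than the printed energy decay (8).
[cite: Hlomuka2010, Lemma 8.1 p.161; (22) p.161; (16) p.158] -/
theorem step4_Lemma81_holds : Step4_Lemma81 := by
  intro Ω _ _ _ _ _ _ _ _ _ _ α _ hα1
  refine ⟨0, fun v _ hv t ht => ?_⟩
  have h0 : l2NormSq Ω (v t) = 0 := by
    unfold l2NormSq
    refine setIntegral_eq_zero_of_forall_eq_zero fun x hx => ?_
    rw [(eq22_iff_zero hα1.ne).1 hv t ht x hx, norm_zero, zero_pow two_ne_zero]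
  rw [h0, Real.sqrt_zero]

end

end Literature.Claims.NS.Hlomuka2010
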